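import Summits.AtomisticToContinuum.HydrodynamicLimit.Theorems.RelayRaceLocalityLightConeInLawStubTimeZero
import Summits.AtomisticToContinuum.HydrodynamicLimit.Theorems.ImplosionDichotomyHydroLimitInBandEquilibrium
import Summits.AtomisticToContinuum.HydrodynamicLimit.Theorems.JParityClosureOddContactSymmetryGibbsInvariance
import Literature.MathematicalPhysics.KineticTheory.HardSphereEulerProofs
import Literature.MathematicalPhysics.KineticTheory.HardSphereBBGKYLiouvilleFlow
import Literature.Analysis.FluidPDE.HardSphereMomentumConservation

/-!
# Stub `stub_equilibrium` (rung 0) of the line `Sketch` for the crux `LightConeInLaw`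
(stmt-AtomisticToContinuum-12500; route `RelayRaceLocality`, sub-problem `HydrodynamicLimit`)

The homogeneous special case of the positive-time two-copy light cone in law. When BOTH hard-sphere
gases are homogeneous — constant activity / velocity / temperature profiles `(cᵢ, ucᵢ, θcᵢ)` — their
canonical laws `Pᵢ = particleLaw Φ (canonicalDensity G3 ε n (localGibbsProfile cᵢ ucᵢ θcᵢ))` are
INVARIANT under the hard-sphere flow (`map_flow_particleLaw_const`, the registered helper, for every
diameter `ε` and particle number `n`): Liouville's theorem (`HardSphereFlow.measurePreserving`) plus
invariance of the density on the conull good set — the density is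
`Z⁻¹ · 𝟙_{D_ε} · cⁿ · ∏ᵢ M_{1,uc,θc}(vᵢ)`, a function of
`∑ᵢ ‖vᵢ − uc‖² = 2E − 2⟪P, uc⟫ + n‖uc‖²` (`sum_norm_vel_sub_sq_eq`), conserved along good orbits by
`HardSphereFlow.configEnergy_flow` / `HardSphereFlow.configMomentum_flow`, while good orbits stay in
the good set `⊆ D_ε`. Hence the expectation of every observable evaluated along the flow at time `t`
equals its expectation at time `0` (`integral_comp_flow_particleLaw_const`), and the time-`0` slice
`TimeZero.stub_timeZero` (bounded-Lipschitz merging under the two laws of large numbers, agreement of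
the reduced data on `B(x₀, R) ⊇ B(x₀, r) ⊇ supp χ`) gives `stub_equilibrium`.

The invariance lemmas generalise `tensorPow_localGibbsProfile_const_flow`,
`canonicalDensity_const_flow`, `map_flow_localGibbsLaw_const` of
`Theorems/JParityClosureOddContactSymmetryGibbsInvariance.lean` (stated there for the special family
`localGibbsLaw σ … N Φ`: `N + 1` spheres of diameter `hsDiameter σ N`) to arbitrary `(ε, n)`.

References: H. Spohn, *Large Scale Dynamics of Interacting Particles* (1991), Part I §2.3
(equilibrium measures are invariant under the dynamics); GST 2013 Prop. 4.1.1.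
-/

namespace Summit.AtomisticToContinuum.HydrodynamicLimit.Theorems.LightConeInLawSketch

open scoped BigOperators Topology Classical ENNReal
open Filter Set MeasureTheory
open Literature.MathematicalPhysics.KineticTheory Literature.Analysis.FluidPDE

namespace Equilibrium

noncomputable section

/-! ### Invariance of the homogeneous canonical law (every `ε`, every `n`) -/

/-- **The homogeneous Gibbs weight is invariant along good orbits, for every particle number `n` and
diameter `ε`** (generalises `tensorPow_localGibbsProfile_const_flow`, stated for `N + 1` spheres of
diameter `hsDiameter σ N`): energy and momentum are conserved by the hard-sphere flow
(`HardSphereFlow.configEnergy_flow`, `HardSphereFlow.configMomentum_flow`) and the weight depends on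
the velocities only through `∑ᵢ ‖vᵢ − u‖² = 2E − 2⟪P, u⟫ + n‖u‖²`. -/
theorem tensorPow_const_flow_eq (c θc : ℝ) (uc : V3) {ε : ℝ} {n : ℕ} (Φ : HardSphereFlow G3 ε n)
    {z : Config n (Fin 3) T3} (hz : z ∈ Φ.good) (t : ℝ) :
    tensorPow n (localGibbsProfile (fun _ => c) (fun _ => uc) (fun _ => θc)) (Φ.flow t z) =
      tensorPow n (localGibbsProfile (fun _ => c) (fun _ => uc) (fun _ => θc)) z := by
  -- adapted from `tensorPow_localGibbsProfile_const_flow` (JParityClosureOddContactSymmetryGibbsInvariance)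
  rw [tensorPow_localGibbsProfile_const, tensorPow_localGibbsProfile_const, sum_norm_vel_sub_sq_eq,
    sum_norm_vel_sub_sq_eq, Φ.configEnergy_flow hz t, Φ.configMomentum_flow hz t]

/-- The homogeneous canonical density is invariant along good orbits, for every `n` and `ε` (the
hard-sphere domain indicator is invariant too: good orbits stay in the good set `⊆ D_ε`). -/
theorem canonicalDensity_const_flow_eq (c θc : ℝ) (uc : V3) {ε : ℝ} {n : ℕ}
    (Φ : HardSphereFlow G3 ε n) {z : Config n (Fin 3) T3} (hz : z ∈ Φ.good) (t : ℝ) :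
    canonicalDensity G3 ε n (localGibbsProfile (fun _ => c) (fun _ => uc) (fun _ => θc))
        (Φ.flow t z) =
      canonicalDensity G3 ε n (localGibbsProfile (fun _ => c) (fun _ => uc) (fun _ => θc)) z := by
  -- adapted from `BoltzmannGreenKuboOrthMomentum.canonicalDensity_const_flow`
  simp only [canonicalDensity]
  rw [Set.indicator_of_mem (Φ.good_subset (Φ.mapsTo_good t hz)),
    Set.indicator_of_mem (Φ.good_subset hz), tensorPow_const_flow_eq c θc uc Φ hz t]

/-- **REGISTERED HELPER `map_flow_particleLaw_const`: the homogeneous canonical law is invariant under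
every hard-sphere flow.** For constant activity / velocity / temperature profiles `(c, uc, θc)`, every
diameter `ε`, particle number `n`, flow `Φ` and time `t`, the push-forward under `Φ_t` of
`P = particleLaw Φ (canonicalDensity G3 ε n (localGibbsProfile c uc θc))` is `P` itself: Liouville's
theorem (`HardSphereFlow.measurePreserving`) plus invariance of the density on the conull good set
(`canonicalDensity_const_flow_eq`). No hypothesis on `c, θc, ε, n` (degenerate cases give the same
junk/zero measure on both sides). -/
theorem map_flow_particleLaw_const :
    ∀ (c θc : ℝ) (uc : V3) (ε : ℝ) (n : ℕ) (Φ : HardSphereFlow G3 ε n) (t : ℝ),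
      (particleLaw Φ (canonicalDensity G3 ε n
          (localGibbsProfile (fun _ => c) (fun _ => uc) (fun _ => θc)))).map (Φ.flow t) =
        particleLaw Φ (canonicalDensity G3 ε n
          (localGibbsProfile (fun _ => c) (fun _ => uc) (fun _ => θc))) := by
  -- adapted from `BoltzmannGreenKuboOrthMomentum.map_flow_localGibbsLaw_const`
  intro c θc uc ε n Φ t
  set L := liouville G3 n ε with hL
  set ρ : Config n (Fin 3) T3 → ℝ≥0∞ := fun z => ENNReal.ofReal
    (canonicalDensity G3 ε n (localGibbsProfile (fun _ => c) (fun _ => uc) (fun _ => θc)) z) with hρ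
  have hG : particleLaw Φ (canonicalDensity G3 ε n
      (localGibbsProfile (fun _ => c) (fun _ => uc) (fun _ => θc))) = L.withDensity ρ := by
    simp only [particleLaw_eq, hL, hρ]
  have hρm : Measurable ρ :=
    (measurable_canonicalDensity ε n
      (measurable_localGibbsProfile continuous_const continuous_const continuous_const)).ennreal_ofReal
  rw [hG]
  ext A hA
  rw [Measure.map_apply (Φ.measurable_flow t) hA,
    withDensity_apply _ (hA.preimage (Φ.measurable_flow t)), withDensity_apply _ hA,
    ← lintegral_indicator (hA.preimage (Φ.measurable_flow t)), ← lintegral_indicator hA]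
  have key : (fun z => (Φ.flow t ⁻¹' A).indicator ρ z) =ᵐ[L] fun z => (A.indicator ρ) (Φ.flow t z) := by
    filter_upwards [Φ.ae_mem_good] with z hz
    by_cases h : Φ.flow t z ∈ A
    · rw [Set.indicator_of_mem h, Set.indicator_of_mem (show z ∈ Φ.flow t ⁻¹' A from h), hρ]
      simp only []
      rw [canonicalDensity_const_flow_eq c θc uc Φ hz t]
    · rw [Set.indicator_of_notMem h, Set.indicator_of_notMem (show z ∉ Φ.flow t ⁻¹' A from h)]
  rw [lintegral_congr_ae key]
  exact (Φ.measurePreserving t).lintegral_comp (hρm.indicator hA)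

/-- `MeasurePreserving` form of `map_flow_particleLaw_const`: every flow map `Φ_t` preserves the
homogeneous canonical law. -/
theorem measurePreserving_flow_particleLaw_const (c θc : ℝ) (uc : V3) {ε : ℝ} {n : ℕ}
    (Φ : HardSphereFlow G3 ε n) (t : ℝ) :
    MeasurePreserving (Φ.flow t)
      (particleLaw Φ (canonicalDensity G3 ε n
        (localGibbsProfile (fun _ => c) (fun _ => uc) (fun _ => θc))))
      (particleLaw Φ (canonicalDensity G3 ε n
        (localGibbsProfile (fun _ => c) (fun _ => uc) (fun _ => θc)))) :=
  ⟨Φ.measurable_flow t, map_flow_particleLaw_const c θc uc ε n Φ t⟩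

/-! ### Stationarity of expectations -/

/-- **Stationarity of expectations under the homogeneous canonical law**: for every flow map `Φ_t`
and every a.e.-strongly measurable observable `g`, `∫ g (Φ_t z) dP = ∫ g dP`. -/
theorem integral_comp_flow_particleLaw_const (c θc : ℝ) (uc : V3) {ε : ℝ} {n : ℕ}
    (Φ : HardSphereFlow G3 ε n) (t : ℝ) {E : Type*} [NormedAddCommGroup E] [NormedSpace ℝ E]
    {g : Config n (Fin 3) T3 → E}
    (hg : AEStronglyMeasurable g (particleLaw Φ (canonicalDensity G3 ε n
        (localGibbsProfile (fun _ => c) (fun _ => uc) (fun _ => θc))))) :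
    ∫ z, g (Φ.flow t z) ∂(particleLaw Φ (canonicalDensity G3 ε n
        (localGibbsProfile (fun _ => c) (fun _ => uc) (fun _ => θc)))) =
      ∫ z, g z ∂(particleLaw Φ (canonicalDensity G3 ε n
        (localGibbsProfile (fun _ => c) (fun _ => uc) (fun _ => θc)))) := by
  -- adapted from `integral_comp_flow_localGibbsLaw_const` (JParityClosureOddContactSymmetryGibbsInvariance)
  have h := measurePreserving_flow_particleLaw_const c θc uc Φ t
  have hg' : AEStronglyMeasurable g ((particleLaw Φ (canonicalDensity G3 ε n
      (localGibbsProfile (fun _ => c) (fun _ => uc) (fun _ => θc)))).map (Φ.flow t)) := by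
    rwa [h.map_eq]
  rw [← integral_map (Φ.measurable_flow t).aemeasurable hg', h.map_eq]

/-- The bounded-Lipschitz functional of the reduced triple `(σ³ ρ_N(χ), σ³ • j_N(χ), σ³ e_N(χ))` is a
measurable function of the configuration (`F` is continuous, the fields are measurable). -/
theorem measurable_comp_reducedTriple {n : ℕ} (σ : ℝ) {χ : T3 → ℝ} (hχ : Continuous χ)
    {F : ℝ × V3 × ℝ → ℝ} (hF : Continuous F) :
    Measurable fun w : Config n (Fin 3) T3 =>
      F (σ ^ 3 * empiricalDensityField w χ, (σ ^ 3) • empiricalMomentumField w χ,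
        σ ^ 3 * empiricalEnergyField w χ) :=
  hF.measurable.comp (((measurable_empiricalDensityField hχ).const_mul _).prodMk
    (((measurable_empiricalMomentumField hχ).fun_const_smul _).prodMk
      ((measurable_empiricalEnergyField hχ).const_mul _)))

/-! ### The stub -/

/-- **STUB `stub_equilibrium` (rung 0 of the positive-time two-copy light cone in law).** When both
gases are homogeneous (constant activity / velocity / temperature profiles) their canonical laws are
invariant under the hard-sphere flows (`map_flow_particleLaw_const`), so the expectation of every
observable evaluated at time `t` equals its expectation at time `0`
(`integral_comp_flow_particleLaw_const`); at time `0` the slice `TimeZero.stub_timeZero` (merging of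
the two bounded-Lipschitz expectations under the time-`0` laws of large numbers and the agreement of
the reduced data on `B(x₀, R)`, with `χ = 0` off `B(x₀, r) ⊆ B(x₀, R)`) concludes. -/
theorem stub_equilibrium :
    ∀ (c₁ θc₁ c₂ θc₂ : ℝ) (uc₁ uc₂ : V3) (n₁ n₂ : ℕ → ℕ) (ε₁ ε₂ : ℕ → ℝ) (σ₁ σ₂ : ℝ), 0 < σ₁ → 0 < σ₂ →
    ∀ (Φ₁ : (N : ℕ) → HardSphereFlow G3 (ε₁ N) (n₁ N))
      (Φ₂ : (N : ℕ) → HardSphereFlow G3 (ε₂ N) (n₂ N)),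
    (∀ N, IsProbabilityMeasure (particleLaw (Φ₁ N) (canonicalDensity G3 (ε₁ N) (n₁ N)
      (localGibbsProfile (fun _ => c₁) (fun _ => uc₁) (fun _ => θc₁))))) →
    (∀ N, IsProbabilityMeasure (particleLaw (Φ₂ N) (canonicalDensity G3 (ε₂ N) (n₂ N)
      (localGibbsProfile (fun _ => c₂) (fun _ => uc₂) (fun _ => θc₂))))) →
    ∀ (ρ₁ Θ₁ ρ₂ Θ₂ : T3 → ℝ) (U₁ U₂ : T3 → V3),
      LLNAt n₁ (fun N => particleLaw (Φ₁ N) (canonicalDensity G3 (ε₁ N) (n₁ N)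
        (localGibbsProfile (fun _ => c₁) (fun _ => uc₁) (fun _ => θc₁)))) Φ₁ ρ₁ U₁ Θ₁ 0 →
      LLNAt n₂ (fun N => particleLaw (Φ₂ N) (canonicalDensity G3 (ε₂ N) (n₂ N)
        (localGibbsProfile (fun _ => c₂) (fun _ => uc₂) (fun _ => θc₂)))) Φ₂ ρ₂ U₂ Θ₂ 0 →
    ∀ (t : ℝ) (x₀ : T3) (R r : ℝ), r ≤ R →
      (∀ x, Torus.euclidDist x x₀ < R →
        ρ₁ x * σ₁ ^ 3 = ρ₂ x * σ₂ ^ 3 ∧ U₁ x = U₂ x ∧ Θ₁ x = Θ₂ x) →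
    ∀ χ : T3 → ℝ, Continuous χ → (∀ x, r ≤ Torus.euclidDist x x₀ → χ x = 0) →
    ∀ F : ℝ × V3 × ℝ → ℝ, LipschitzWith 1 F → (∀ p, |F p| ≤ 1) →
      Tendsto (fun N =>
        (∫ z, F (σ₁ ^ 3 * empiricalDensityField ((Φ₁ N).flow t z) χ,
            (σ₁ ^ 3) • empiricalMomentumField ((Φ₁ N).flow t z) χ,
            σ₁ ^ 3 * empiricalEnergyField ((Φ₁ N).flow t z) χ)
          ∂(particleLaw (Φ₁ N) (canonicalDensity G3 (ε₁ N) (n₁ N)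
              (localGibbsProfile (fun _ => c₁) (fun _ => uc₁) (fun _ => θc₁))))) -
        ∫ z, F (σ₂ ^ 3 * empiricalDensityField ((Φ₂ N).flow t z) χ,
            (σ₂ ^ 3) • empiricalMomentumField ((Φ₂ N).flow t z) χ,
            σ₂ ^ 3 * empiricalEnergyField ((Φ₂ N).flow t z) χ)
          ∂(particleLaw (Φ₂ N) (canonicalDensity G3 (ε₂ N) (n₂ N)
              (localGibbsProfile (fun _ => c₂) (fun _ => uc₂) (fun _ => θc₂))))) atTop (𝓝 0) := by
  intro c₁ θc₁ c₂ θc₂ uc₁ uc₂ n₁ n₂ ε₁ ε₂ σ₁ σ₂ hσ₁ hσ₂ Φ₁ Φ₂ hP₁ hP₂ ρ₁ Θ₁ ρ₂ Θ₂ U₁ U₂ hL₁ hL₂ t x₀ R r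
    hrR hagree χ hχ hsupp F hF hFb
  -- `χ` vanishes off the larger ball `B(x₀, R)`
  have hsuppR : ∀ x, R ≤ Torus.euclidDist x x₀ → χ x = 0 := fun x hx => hsupp x (hrR.trans hx)
  -- the slice `t = 0`
  have h0 := TimeZero.stub_timeZero n₁ n₂ ε₁ ε₂ σ₁ σ₂ hσ₁ hσ₂ Φ₁ Φ₂
    (fun N => particleLaw (Φ₁ N) (canonicalDensity G3 (ε₁ N) (n₁ N)
      (localGibbsProfile (fun _ => c₁) (fun _ => uc₁) (fun _ => θc₁))))
    (fun N => particleLaw (Φ₂ N) (canonicalDensity G3 (ε₂ N) (n₂ N)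
      (localGibbsProfile (fun _ => c₂) (fun _ => uc₂) (fun _ => θc₂))))
    hP₁ hP₂ ρ₁ Θ₁ ρ₂ Θ₂ U₁ U₂ hL₁ hL₂ x₀ R hagree χ hχ hsuppR F hF hFb
  -- stationarity: the time-`t` and the time-`0` expectations both equal the static expectation
  have hG₁ := fun n : ℕ => (measurable_comp_reducedTriple (n := n) σ₁ hχ hF.continuous)
  have hG₂ := fun n : ℕ => (measurable_comp_reducedTriple (n := n) σ₂ hχ hF.continuous)
  have key₁ : ∀ N,
      ∫ z, F (σ₁ ^ 3 * empiricalDensityField ((Φ₁ N).flow t z) χ,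
          (σ₁ ^ 3) • empiricalMomentumField ((Φ₁ N).flow t z) χ,
          σ₁ ^ 3 * empiricalEnergyField ((Φ₁ N).flow t z) χ)
        ∂(particleLaw (Φ₁ N) (canonicalDensity G3 (ε₁ N) (n₁ N)
            (localGibbsProfile (fun _ => c₁) (fun _ => uc₁) (fun _ => θc₁)))) =
      ∫ z, F (σ₁ ^ 3 * empiricalDensityField ((Φ₁ N).flow 0 z) χ,
          (σ₁ ^ 3) • empiricalMomentumField ((Φ₁ N).flow 0 z) χ,
          σ₁ ^ 3 * empiricalEnergyField ((Φ₁ N).flow 0 z) χ)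
        ∂(particleLaw (Φ₁ N) (canonicalDensity G3 (ε₁ N) (n₁ N)
            (localGibbsProfile (fun _ => c₁) (fun _ => uc₁) (fun _ => θc₁)))) := fun N =>
    (integral_comp_flow_particleLaw_const c₁ θc₁ uc₁ (Φ₁ N) t
      (hG₁ (n₁ N)).aestronglyMeasurable).trans
    (integral_comp_flow_particleLaw_const c₁ θc₁ uc₁ (Φ₁ N) 0
      (hG₁ (n₁ N)).aestronglyMeasurable).symm
  have key₂ : ∀ N,
      ∫ z, F (σ₂ ^ 3 * empiricalDensityField ((Φ₂ N).flow t z) χ,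
          (σ₂ ^ 3) • empiricalMomentumField ((Φ₂ N).flow t z) χ,
          σ₂ ^ 3 * empiricalEnergyField ((Φ₂ N).flow t z) χ)
        ∂(particleLaw (Φ₂ N) (canonicalDensity G3 (ε₂ N) (n₂ N)
            (localGibbsProfile (fun _ => c₂) (fun _ => uc₂) (fun _ => θc₂)))) =
      ∫ z, F (σ₂ ^ 3 * empiricalDensityField ((Φ₂ N).flow 0 z) χ,
          (σ₂ ^ 3) • empiricalMomentumField ((Φ₂ N).flow 0 z) χ,
          σ₂ ^ 3 * empiricalEnergyField ((Φ₂ N).flow 0 z) χ)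
        ∂(particleLaw (Φ₂ N) (canonicalDensity G3 (ε₂ N) (n₂ N)
            (localGibbsProfile (fun _ => c₂) (fun _ => uc₂) (fun _ => θc₂)))) := fun N =>
    (integral_comp_flow_particleLaw_const c₂ θc₂ uc₂ (Φ₂ N) t
      (hG₂ (n₂ N)).aestronglyMeasurable).trans
    (integral_comp_flow_particleLaw_const c₂ θc₂ uc₂ (Φ₂ N) 0
      (hG₂ (n₂ N)).aestronglyMeasurable).symm
  exact (tendsto_congr fun N => by rw [key₁ N, key₂ N]).2 h0

end

end Equilibrium

end Summit.AtomisticToContinuum.HydrodynamicLimit.Theorems.LightConeInLawSketch
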